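import Mathlib
import Summits.Ventures.PercRepro2.K5Kernel
import Summits.Ventures.PercRepro2.K5Kron
import Summits.Ventures.PercRepro2.K5Digits
import Summits.Ventures.PercRepro2.PMK5Kernel
import Summits.Ventures.PercRepro2.PMK5Bridge

/-!
# The `K₅` kernel certificate of the `a₃`-INACTIVE covariance form (the typed BHK 1.4 on `K₅`)
(blind cell PercRepro2, mine-2 g22; for row 2′TRI on the `K₅ + pendant` family)

With `a₃` inactive the covariance form is `Gc₀ = 2 P(Q) [S(bL, oH) + S(bH, oL)]` (`A3Inactive.Gc_eq_of_a3Inactive`,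
`PMPendant.Gc_pendant_zero_eq`), `S(bL, oH) = P(Q, bL) P(Q, oH) − P(Q) P(Q, oH, bL)`,
`S(bH, oL) = P(Q, bH) P(Q, oL) − P(Q) P(Q, oL, bH)` — four products of three masses (marks
`o = 0, a₁ = 1, a₂ = 2, b = 4` on `K₅`; the tables `tQ`, `tQBL`, `tQB`, `tQHo`, `tQLo`, `tQBLHo`, `tQBLo`).
**`certI`** (one `decide +kernel`): every degree-3 tensor-Bernstein coefficient of `Gc₀ / 2` is `≥ 0` — the
3-copy class sums of the collapsed kernel `iQ(x)·psi(y, w)` of `A3InactiveTyped.lean` are nonnegative on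
`K₅` for every profile (the spectator form of the typed BHK 1.4, `TB14`, on `K₅`; `TB14` itself is a
CANDIDATE of record in the tree).  `cntNegI_le_cntPosI` is the digit argument (`K5.le_of_kron_le`).
-/

namespace Summit.Ventures.PercRepro2

namespace K5

namespace PM

/-- The positive part of the cleared `a₃`-inactive form (halved): `kron Q·kron(L_bQ)·kron(H_oQ) + kron Q·kron(H_bQ)·kron(L_oQ)`. -/
def kPosI : ℕ := kron tQ * kron tQBL * kron tQHo + kron tQ * kron tQB * kron tQLo

/-- The negative part: `kron Q·kron Q·kron(H_bL_oQ) + kron Q·kron Q·kron(L_bH_oQ)`. -/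
def kNegI : ℕ := kron tQ * kron tQ * kron tQBLo + kron tQ * kron tQ * kron tQBLHo

set_option maxRecDepth 100000 in
set_option maxHeartbeats 0 in
/-- **The `K₅` certificate of the `a₃`-inactive form**: `kPosI ≥ kNegI` digitwise. -/
theorem certI : kNegI ≤ kPosI ∧ Nat.land (kPosI - kNegI) mask = 0 ∧ Nat.land kNegI mask = 0 := by
  decide +kernel

/-- The positive triple counts. -/
def cntPosI (k : Fin 10 → Fin 4) : ℕ := cnt3 tQ tQBL tQHo k + cnt3 tQ tQB tQLo k

/-- The negative triple counts. -/
def cntNegI (k : Fin 10 → Fin 4) : ℕ := cnt3 tQ tQ tQBLo k + cnt3 tQ tQ tQBLHo k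

/-- `kPosI` carries the positive counts. -/
lemma kPosI_eq : kPosI = ∑ k, cntPosI k * KB ^ idx4 k :=
  calc kPosI = kronSum tQ * kronSum tQBL * kronSum tQHo + kronSum tQ * kronSum tQB * kronSum tQLo := by
        unfold kPosI
        rw [kron_eq_kronSum tQ, kron_eq_kronSum tQBL, kron_eq_kronSum tQHo, kron_eq_kronSum tQB,
          kron_eq_kronSum tQLo]
    _ = ∑ k, cnt3 tQ tQBL tQHo k * KB ^ idx4 k + ∑ k, cnt3 tQ tQB tQLo k * KB ^ idx4 k := by
        rw [kronSum_mul_mul, kronSum_mul_mul]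
    _ = ∑ k, cntPosI k * KB ^ idx4 k := sum_add_mul5 _ _

/-- `kNegI` carries the negative counts. -/
lemma kNegI_eq : kNegI = ∑ k, cntNegI k * KB ^ idx4 k :=
  calc kNegI = kronSum tQ * kronSum tQ * kronSum tQBLo + kronSum tQ * kronSum tQ * kronSum tQBLHo := by
        unfold kNegI
        rw [kron_eq_kronSum tQ, kron_eq_kronSum tQBLo, kron_eq_kronSum tQBLHo]
    _ = ∑ k, cnt3 tQ tQ tQBLo k * KB ^ idx4 k + ∑ k, cnt3 tQ tQ tQBLHo k * KB ^ idx4 k := by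
        rw [kronSum_mul_mul, kronSum_mul_mul]
    _ = ∑ k, cntNegI k * KB ^ idx4 k := sum_add_mul5 _ _

/-- The counts are bounded by `2 · 3^10 < 2^19`. -/
lemma cntPosI_lt (k : Fin 10 → Fin 4) : cntPosI k < 2 ^ 19 := by
  unfold cntPosI
  have := cnt3_le tQ tQBL tQHo k
  have := cnt3_le tQ tQB tQLo k
  omega

/-- The counts are bounded by `2 · 3^10 < 2^19`. -/
lemma cntNegI_lt (k : Fin 10 → Fin 4) : cntNegI k < 2 ^ 19 := by
  unfold cntNegI
  have := cnt3_le tQ tQ tQBLo k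
  have := cnt3_le tQ tQ tQBLHo k
  omega

/-- **Every Bernstein coefficient of the `a₃`-inactive form on `K₅` is `≥ 0`** (from `certI`). -/
theorem cntNegI_le_cntPosI (k : Fin 10 → Fin 4) : cntNegI k ≤ cntPosI k :=
  le_of_kron_le cntPosI cntNegI cntPosI_lt cntNegI_lt kPosI_eq kNegI_eq certI.1 certI.2.1 k

end PM

end K5

end Summit.Ventures.PercRepro2
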